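import Summits.RiemannHypothesis.RiemannHypothesis.Theorems.WeilFormatCCinfExactTables
import HarnessLib

/-!
# Format C, design C∞ (E2, data side): COLUMN and 2×2 BLOCK gluing of claimed tables

Route context: Fourier–Galerkin / Schur-complement certificates of Weil positivity on a window ("format C", C∞ door
`weilPositivityOn_of_cinf_cert`, `WeilFormatCCinfDoorCert`; supporting stmt-RiemannHypothesis-0098; seat rh-explicit-weil-2,
cell memo `run/shared/lean/pub/rh-explicit/rh-explicit-weil-2/gen16/E2F-CERT-PIPELINE.md` §6).

The entrywise assembly `CinfAsmE.SR_eq` (`WeilFormatCCinfCertAssembleEven/Odd`) reads the "constant part" of the sector matrix from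
ONE glued `(B + r) × (B + r)` function `CfullN` whose four blocks — kernel block `(x,x)`, resolved cross blocks `(x,β)` / `(β,x)`,
profile block `(β,β)` — come from four different stage outputs.  `CinfGlue.TabNear.append_rows` (`WeilFormatCCinfCertGlue`) glues ROW
blocks; this file adds the COLUMN glue and the 2×2 block glue, over `WeilFormatCCinfExactTables` only:

* `CinfBlocks.hcat Z₁ Z₂` — rowwise concatenation (`zipWith (++)`), `getMZ_hcat_left/right`;
* `checkHcat Z₁ Z₂ n k₁` — the shape check (both tables have ≥ `n` rows, the rows of `Z₁` below `n` have length exactly `k₁`);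
* ★ `TabNear.hcat` — `TabNear f n k₁ c ρ Z₁ → TabNear g n k₂ c ρ Z₂ → checkHcat … → TabNear (f | g) n (k₁ + k₂) c ρ (hcat Z₁ Z₂)`;
* ★ `TabNear.block4` — the four blocks `Z₁₁ (B×B), Z₁₂ (B×r), Z₂₁ (r×B), Z₂₂ (r×r)` (one scale, one radius — equalise first with
  `CinfGlue.TabNear.mono_scale` / `CinfExact.TabNear.mono`) give the claimed table `hcat Z₁₁ Z₁₂ ++ hcat Z₂₁ Z₂₂` of the glued function
  `fun p p' ↦ if p < B then (if p' < B then f₁₁ p p' else f₁₂ p (p' − B)) else (if p' < B then f₂₁ (p − B) p' else f₂₂ (p − B) (p' − B))`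
  — the shape of `CinfAsmE.CfullN` on the index range (`CinfGlue.TabNear.congr` does the renaming);
* `col0` / `VecNear.col0` — column `0` of a claimed `n × 1` table (a stage-T output with `Nm = 1`, e.g. the remainder diagonal
  `RDN`) as the claimed VECTOR the entrywise stage E consumes;
* `scaleZ` / `TabNear.rescale` — the same claim at a finer scale `c + e` (entries and radius times `2^e`), to equalise block scales;
* `idZ` / `getMZ_idZ` / `ite_eq_getMZ_idZ` / `ite_eq_getMZ_idZ'` — the scalar table `z·I` and the EXACTNESS of the Kronecker pairs
  (`P s p q = [q = p]`) of the stage-L instances (`CinfColE.Pgx/Pax`, `CinfAsmE` cross pairs) against `idZ n (2^cC)`;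
* `checkEntry2` / `checkEntry2T` + `eq_of_checkEntry2(T)` — a Boolean entrywise check `Z[p][q] = a·W[q][p]·2^e` (resp. not
  transposed) turns a table `W` the rung DEFINES a real object from (free maps `Λ1, Λ2` at scale `cW`) into the exact side
  `a · (W[q][p]/2^cW) = Z[p][q]/2^cC` (`cC = cW + e`) of a stage-L pair (`−Λ1ᵀ`, `−2Λ1ᵀ`, `−Λ2(q,·)`, …).

Bookkeeping only; standard axioms; no RH claim.
-/

set_option autoImplicit false
-- `Summit.RiemannHypothesis.RiemannHypothesis.…` is the layout-mandated namespace (summit = problem name).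
set_option linter.dupNamespace false

namespace Summit.RiemannHypothesis.RiemannHypothesis.Theorems.WeilFormatC

namespace CinfBlocks

open Literature.NumberTheory.LFunctions (PsdDyadic.getMZ)

/-! ## Column concatenation -/

/-- Rowwise concatenation of two tables (row `i` is `Z₁[i] ++ Z₂[i]`; truncates to the shorter table). -/
def hcat (Z₁ Z₂ : List (List ℤ)) : List (List ℤ) := List.zipWith (· ++ ·) Z₁ Z₂

/-- Row `i` of `hcat`. -/
theorem getD_hcat {Z₁ Z₂ : List (List ℤ)} {i : ℕ} (h₁ : i < Z₁.length) (h₂ : i < Z₂.length) :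
    (hcat Z₁ Z₂).getD i [] = Z₁.getD i [] ++ Z₂.getD i [] := by
  rw [hcat, List.getD_eq_getElem?_getD, List.getElem?_zipWith, List.getElem?_eq_getElem h₁, List.getElem?_eq_getElem h₂]
  simp [List.getD_eq_getElem?_getD, List.getElem?_eq_getElem h₁, List.getElem?_eq_getElem h₂]

/-- Entries of `hcat`, first part (`t` below the length of the `Z₁`-row). -/
theorem getMZ_hcat_left {Z₁ Z₂ : List (List ℤ)} {i t : ℕ} (h₁ : i < Z₁.length) (h₂ : i < Z₂.length)
    (ht : t < (Z₁.getD i []).length) : PsdDyadic.getMZ (hcat Z₁ Z₂) i t = PsdDyadic.getMZ Z₁ i t := by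
  rw [PsdDyadic.getMZ, PsdDyadic.getMZ, getD_hcat h₁ h₂, List.getD_eq_getElem?_getD, List.getElem?_append_left ht,
    ← List.getD_eq_getElem?_getD]

/-- Entries of `hcat`, second part. -/
theorem getMZ_hcat_right {Z₁ Z₂ : List (List ℤ)} {i t : ℕ} (h₁ : i < Z₁.length) (h₂ : i < Z₂.length)
    (ht : (Z₁.getD i []).length ≤ t) :
    PsdDyadic.getMZ (hcat Z₁ Z₂) i t = PsdDyadic.getMZ Z₂ i (t - (Z₁.getD i []).length) := by
  rw [PsdDyadic.getMZ, PsdDyadic.getMZ, getD_hcat h₁ h₂, List.getD_eq_getElem?_getD, List.getElem?_append_right ht,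
    ← List.getD_eq_getElem?_getD]

/-- Length of `hcat`. -/
theorem length_hcat (Z₁ Z₂ : List (List ℤ)) : (hcat Z₁ Z₂).length = min Z₁.length Z₂.length := by
  rw [hcat, List.length_zipWith]

/-- **Shape check** for the column glue: both tables have at least `n` rows and every `Z₁`-row below `n` has length `k₁`. -/
def checkHcat (Z₁ Z₂ : List (List ℤ)) (n k₁ : ℕ) : Bool :=
  decide (n ≤ Z₁.length) && decide (n ≤ Z₂.length)
    && CinfExact.allFromTo 0 n fun i ↦ decide ((Z₁.getD i []).length = k₁)

/-- What `checkHcat` certifies. -/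
theorem checkHcat_spec {Z₁ Z₂ : List (List ℤ)} {n k₁ : ℕ} (h : checkHcat Z₁ Z₂ n k₁ = true) :
    n ≤ Z₁.length ∧ n ≤ Z₂.length ∧ ∀ i < n, (Z₁.getD i []).length = k₁ := by
  simp only [checkHcat, Bool.and_eq_true, decide_eq_true_eq] at h
  obtain ⟨⟨h1, h2⟩, h3⟩ := h
  refine ⟨h1, h2, fun i hi ↦ ?_⟩
  have := CinfExact.allFromTo_spec h3 i (Nat.zero_le _) (by simpa using hi)
  rwa [decide_eq_true_eq] at this

/-- ★ **Glued columns**: `k₁` claimed columns of `f` followed by `k₂` claimed columns of `g` (same rows, scale, radius). -/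
theorem TabNear.hcat {f g : ℕ → ℕ → ℝ} {n k₁ k₂ c ρ : ℕ} {Z₁ Z₂ : List (List ℤ)}
    (hf : CinfExact.TabNear f n k₁ c ρ Z₁) (hg : CinfExact.TabNear g n k₂ c ρ Z₂) (hs : checkHcat Z₁ Z₂ n k₁ = true) :
    CinfExact.TabNear (fun i t ↦ if t < k₁ then f i t else g i (t - k₁)) n (k₁ + k₂) c ρ (CinfBlocks.hcat Z₁ Z₂) := by
  obtain ⟨hl1, hl2, hrow⟩ := checkHcat_spec hs
  refine ⟨fun i hi t ht ↦ ?_⟩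
  by_cases htk : t < k₁
  · rw [if_pos htk, getMZ_hcat_left (by omega) (by omega) (by rw [hrow i hi]; exact htk)]
    exact hf.out i hi t htk
  · rw [if_neg htk, getMZ_hcat_right (by omega) (by omega) (by rw [hrow i hi]; omega), hrow i hi]
    exact hg.out i hi (t - k₁) (by omega)

/-! ## The 2×2 block glue -/

/-- `getMZ` of appended row blocks, first part. -/
private theorem getMZ_append_of_lt {Z₁ Z₂ : List (List ℤ)} {p : ℕ} (hp : p < Z₁.length) (t : ℕ) :
    PsdDyadic.getMZ (Z₁ ++ Z₂) p t = PsdDyadic.getMZ Z₁ p t := by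
  simp only [PsdDyadic.getMZ, List.getD_eq_getElem?_getD, List.getElem?_append_left hp]

/-- `getMZ` of appended row blocks, second part. -/
private theorem getMZ_append_of_le {Z₁ Z₂ : List (List ℤ)} {p : ℕ} (hp : Z₁.length ≤ p) (t : ℕ) :
    PsdDyadic.getMZ (Z₁ ++ Z₂) p t = PsdDyadic.getMZ Z₂ (p - Z₁.length) t := by
  simp only [PsdDyadic.getMZ, List.getD_eq_getElem?_getD, List.getElem?_append_right hp]

/-- **Shape check** for the 2×2 glue: the top blocks have exactly `B` rows (so the row split of the appended table is at `B`),
the bottom blocks at least `r`, and the left blocks' rows have length exactly `B`. -/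
def checkBlock4 (Z₁₁ Z₁₂ Z₂₁ Z₂₂ : List (List ℤ)) (B r : ℕ) : Bool :=
  decide (Z₁₁.length = B) && decide (Z₁₂.length = B) && checkHcat Z₁₁ Z₁₂ B B && checkHcat Z₂₁ Z₂₂ r B

/-- ★ **The 2×2 block glue** (`x`-indices first): four claimed blocks at one scale and radius give the claimed table
`hcat Z₁₁ Z₁₂ ++ hcat Z₂₁ Z₂₂` of the glued `(B + r) × (B + r)` function. -/
theorem TabNear.block4 {f₁₁ f₁₂ f₂₁ f₂₂ : ℕ → ℕ → ℝ} {B r c ρ : ℕ} {Z₁₁ Z₁₂ Z₂₁ Z₂₂ : List (List ℤ)}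
    (h₁₁ : CinfExact.TabNear f₁₁ B B c ρ Z₁₁) (h₁₂ : CinfExact.TabNear f₁₂ B r c ρ Z₁₂)
    (h₂₁ : CinfExact.TabNear f₂₁ r B c ρ Z₂₁) (h₂₂ : CinfExact.TabNear f₂₂ r r c ρ Z₂₂)
    (hs : checkBlock4 Z₁₁ Z₁₂ Z₂₁ Z₂₂ B r = true) :
    CinfExact.TabNear
      (fun p p' ↦ if p < B then (if p' < B then f₁₁ p p' else f₁₂ p (p' - B))
        else (if p' < B then f₂₁ (p - B) p' else f₂₂ (p - B) (p' - B)))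
      (B + r) (B + r) c ρ (CinfBlocks.hcat Z₁₁ Z₁₂ ++ CinfBlocks.hcat Z₂₁ Z₂₂) := by
  simp only [checkBlock4, Bool.and_eq_true, decide_eq_true_eq] at hs
  obtain ⟨⟨⟨hl11, hl12⟩, hsT⟩, hsB⟩ := hs
  have htop := TabNear.hcat h₁₁ h₁₂ hsT
  have hbot := TabNear.hcat h₂₁ h₂₂ hsB
  have hlen : (CinfBlocks.hcat Z₁₁ Z₁₂).length = B := by rw [length_hcat, hl11, hl12, min_self]
  refine ⟨fun p hp p' hp' ↦ ?_⟩
  by_cases hpB : p < B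
  · rw [if_pos hpB, getMZ_append_of_lt (by rw [hlen]; exact hpB)]
    exact htop.out p hpB p' hp'
  · rw [if_neg hpB, getMZ_append_of_le (by rw [hlen]; omega), hlen]
    exact hbot.out (p - B) (by omega) p' hp'

/-! ## Column `0` of an `n × 1` table as a claimed vector -/

/-- Column `0` of a table, as a list indexed by the row. -/
def col0 (Z : List (List ℤ)) : List ℤ := Z.map fun row ↦ row.getD 0 0

/-- Entries of `col0`. -/
theorem getD_col0 (Z : List (List ℤ)) (p : ℕ) : (col0 Z).getD p 0 = PsdDyadic.getMZ Z p 0 := by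
  simp only [col0, PsdDyadic.getMZ, List.getD_eq_getElem?_getD, List.getElem?_map]
  cases Z[p]? with
  | none => simp
  | some row => simp

/-- **Column `0` as a vector claim**: from `TabNear F n 1 c ρ Z`, `VecNear (F · 0) n c ρ (col0 Z)`. -/
theorem VecNear.col0 {F : ℕ → ℕ → ℝ} {n k c ρ : ℕ} {Z : List (List ℤ)} (h : CinfExact.TabNear F n k c ρ Z) (hk : 1 ≤ k) :
    CinfExact.VecNear (fun p ↦ F p 0) n c ρ (CinfBlocks.col0 Z) :=
  ⟨fun p hp ↦ by rw [getD_col0]; exact h.out p hp 0 (by omega)⟩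

/-! ## Rescaling a claim to a finer scale -/

/-- All entries times `2^e`. -/
def scaleZ (e : ℕ) (Z : List (List ℤ)) : List (List ℤ) := Z.map fun row ↦ row.map fun z ↦ z * 2 ^ e

/-- Entries of `scaleZ`. -/
theorem getMZ_scaleZ (e : ℕ) (Z : List (List ℤ)) (p q : ℕ) :
    PsdDyadic.getMZ (scaleZ e Z) p q = PsdDyadic.getMZ Z p q * 2 ^ e := by
  simp only [PsdDyadic.getMZ, scaleZ, List.getD_eq_getElem?_getD, List.getElem?_map]
  cases Z[p]? with
  | none => simp
  | some row =>
      simp only [Option.map_some, Option.getD_some, List.getElem?_map]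
      cases row[q]? <;> simp

/-- **Rescaling**: a claim at scale `c`, radius `ρ` is the claim at scale `c + e`, radius `ρ·2^e`, of the rescaled table. -/
theorem TabNear.rescale {f : ℕ → ℕ → ℝ} {n k c ρ : ℕ} {Z : List (List ℤ)} (h : CinfExact.TabNear f n k c ρ Z) (e : ℕ) :
    CinfExact.TabNear f n k (c + e) (ρ * 2 ^ e) (CinfBlocks.scaleZ e Z) := by
  refine ⟨fun p hp q hq ↦ ?_⟩
  have h1 := h.out p hp q hq
  have h2 : (0 : ℝ) < 2 ^ e := by positivity
  rw [getMZ_scaleZ]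
  push_cast
  rw [pow_add, mul_div_mul_right _ _ h2.ne', mul_div_mul_right _ _ h2.ne']
  exact h1

/-! ## Scalar tables and the exactness of Kronecker pairs -/

/-- The `n × n` scalar table `z·I`. -/
def idZ (n : ℕ) (z : ℤ) : List (List ℤ) :=
  (List.range n).map fun p ↦ (List.range n).map fun q ↦ if p = q then z else 0

/-- Entries of `idZ`. -/
theorem getMZ_idZ {n : ℕ} (z : ℤ) {p q : ℕ} (hp : p < n) (hq : q < n) :
    PsdDyadic.getMZ (idZ n z) p q = if p = q then z else 0 := by
  simp only [PsdDyadic.getMZ, idZ, List.getD_eq_getElem?_getD, List.getElem?_map, List.getElem?_range hp,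
    Option.map_some, Option.getD_some, List.getElem?_range hq]

/-- **Kronecker pair exactness** (`[q = p]` orientation, as in `CinfColE.Pgx 0`/`Pax 0`): against `idZ n (2^cC)`. -/
theorem ite_eq_getMZ_idZ {n cC p q : ℕ} (hp : p < n) (hq : q < n) :
    (if q = p then (1 : ℝ) else 0) = (PsdDyadic.getMZ (idZ n (2 ^ cC)) p q : ℝ) / 2 ^ cC := by
  have h2 : (0 : ℝ) < 2 ^ cC := by positivity
  rw [getMZ_idZ _ hp hq]
  by_cases hpq : p = q
  · rw [if_pos hpq.symm, if_pos hpq]; push_cast; rw [div_self h2.ne']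
  · rw [if_neg (Ne.symm hpq), if_neg hpq]; simp

/-- **Kronecker pair exactness**, `[p = q]` orientation, general scalar `a`: against `idZ n (a·2^cC)`. -/
theorem ite_eq_getMZ_idZ' {n cC p q : ℕ} (a : ℤ) (hp : p < n) (hq : q < n) :
    (if p = q then (a : ℝ) else 0) = (PsdDyadic.getMZ (idZ n (a * 2 ^ cC)) p q : ℝ) / 2 ^ cC := by
  have h2 : (0 : ℝ) < 2 ^ cC := by positivity
  rw [getMZ_idZ _ hp hq]
  by_cases hpq : p = q
  · rw [if_pos hpq, if_pos hpq]; push_cast; rw [mul_div_assoc, div_self h2.ne', mul_one]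
  · rw [if_neg hpq, if_neg hpq]; simp

/-! ## Exact sides defined from another table (free maps): entrywise relation checks -/

/-- Check `Z[p][q] = a · W[p][q] · 2^e` for `p < n`, `q < k`. -/
def checkEntry2 (Z W : List (List ℤ)) (n k : ℕ) (a : ℤ) (e : ℕ) : Bool :=
  CinfExact.allFromTo 0 n fun p ↦ CinfExact.allFromTo 0 k fun q ↦
    decide (PsdDyadic.getMZ Z p q = a * PsdDyadic.getMZ W p q * 2 ^ e)

/-- Check `Z[p][q] = a · W[q][p] · 2^e` (TRANSPOSED read of `W`) for `p < n`, `q < k`. -/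
def checkEntry2T (Z W : List (List ℤ)) (n k : ℕ) (a : ℤ) (e : ℕ) : Bool :=
  CinfExact.allFromTo 0 n fun p ↦ CinfExact.allFromTo 0 k fun q ↦
    decide (PsdDyadic.getMZ Z p q = a * PsdDyadic.getMZ W q p * 2 ^ e)

/-- **Exact side from a defining table**: `a · (W[p][q]/2^cW) = Z[p][q]/2^cC` on the range, `cC = cW + e`. -/
theorem eq_of_checkEntry2 {Z W : List (List ℤ)} {n k : ℕ} {a : ℤ} {e cW cC : ℕ}
    (h : checkEntry2 Z W n k a e = true) (hc : cC = cW + e) {p q : ℕ} (hp : p < n) (hq : q < k) :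
    (a : ℝ) * ((PsdDyadic.getMZ W p q : ℝ) / 2 ^ cW) = (PsdDyadic.getMZ Z p q : ℝ) / 2 ^ cC := by
  have h1 := CinfExact.allFromTo_spec (CinfExact.allFromTo_spec h p (Nat.zero_le _) (by simpa using hp))
    q (Nat.zero_le _) (by simpa using hq)
  rw [decide_eq_true_eq] at h1
  have h2 : (0 : ℝ) < 2 ^ cW := by positivity
  have h3 : (0 : ℝ) < 2 ^ e := by positivity
  rw [h1, hc, pow_add]; push_cast
  field_simp

/-- **Exact side from a defining table, transposed**: `a · (W[q][p]/2^cW) = Z[p][q]/2^cC` on the range, `cC = cW + e`. -/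
theorem eq_of_checkEntry2T {Z W : List (List ℤ)} {n k : ℕ} {a : ℤ} {e cW cC : ℕ}
    (h : checkEntry2T Z W n k a e = true) (hc : cC = cW + e) {p q : ℕ} (hp : p < n) (hq : q < k) :
    (a : ℝ) * ((PsdDyadic.getMZ W q p : ℝ) / 2 ^ cW) = (PsdDyadic.getMZ Z p q : ℝ) / 2 ^ cC := by
  have h1 := CinfExact.allFromTo_spec (CinfExact.allFromTo_spec h p (Nat.zero_le _) (by simpa using hp))
    q (Nat.zero_le _) (by simpa using hq)
  rw [decide_eq_true_eq] at h1
  have h2 : (0 : ℝ) < 2 ^ cW := by positivity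
  have h3 : (0 : ℝ) < 2 ^ e := by positivity
  rw [h1, hc, pow_add]; push_cast
  field_simp

end CinfBlocks

end Summit.RiemannHypothesis.RiemannHypothesis.Theorems.WeilFormatC
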